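import Literature.Probability.RandomPlanarGeometry.HexSAWStripBridgeKernelResidue
import HarnessLib

/-!
# The β-walks of the honeycomb strip without renewal point are summable at the surface threshold `y_T`
# (module «BETA-NORENEWAL»: the crux of the renewal split of the printed series `B_T(x_c; ·)`)

Topic `Literature/Probability/RandomPlanarGeometry` (continues `HexSAWStripBridgeDecomposition.lean` — the curtain decomposition
`HV.decTriple = (headP, xstd midP, xstd tailP)` of a case-A β-walk into a top-free head, a horizontal Duminil-Copin–Hammond bridge and a
bottom-free tail, `HV.exists_topFreeSumN_le`, `HV.exists_botFreeSumN_le`; `HexSAWStripBridgeRenewal.lean` — renewal indices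
`HV.IsRenewalIdx`, `HV.renIdxs`, `HV.npieces`, the level classes `HV.HBk` and sums `HV.Dk`, `HV.Dmat_le_pow`; `HexSAWStripBridgeKernelResidue.lean`
— the limit kernel `I_T` with its positive right vector `I_T u = u`).  Sources of the SETTING: H. Duminil-Copin, A. Hammond, CMP 324 (2013)
§2.2 (bridges, renewal points, irreducible bridges — here along the column `ξ` of the strip); N. R. Beaton, M. Bousquet-Mélou, J. de Gier,
H. Duminil-Copin, A. J. Guttmann, CMP 326 (2014), arXiv:1109.0358v5, §3.2 (Proposition 6: `ν_T(y)`; Corollary 8: the radius `y_T` of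
`B_T(x_c; ·)`); H. Duminil-Copin, S. Smirnov, Ann. Math. 175 (2012) §3 (the domains `S_{T,L}`, walks `a → β`); E. Seneta, *Non-negative
matrices* (1973), Chapter 6.  None of the sources states the results below; they are the lane's own (lane «pcv-sawmu», a-p2 g19 §1–§2,
a-p2 g20 §3–§5), a step towards the residue and the coefficient law of the PRINTED series `B_T(x_c; ·)` at `y_T`.

## What is proved (namespace `Literature.Probability.RandomPlanarGeometry.SAW.HV`; `x_c = hexCriticalFugacity`, `y_T = stripYT T`)

* §1 ★ `exists_pow_mul_stripZL_le_geometric` — if `x_c ν_T(y) < 1` then `x_cⁿ Z_{T,n}(y) ≤ C θⁿ` (`θ < 1`); ★ `exists_partialSum_succ_mul_stripZL_le`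
  — the FIRST MOMENT `Σ_{n<M} (n+1) x_cⁿ Z_{T,n}(y) ≤ C'`; ★ `exists_topFree_length_mul_le`, ★ `exists_botFree_length_mul_le` — the top-free
  heads (`T ≥ 1`) and the bottom-free tails (`x_c ν_{T−1}(y) < 1`, `T ≥ 2`) of the curtain decomposition have finite first moments in length.
* §2 ★ `isRenewalIdx_of_segment`, `isRenewalIdx_of_midP` — the KEY LEMMA: a renewal index of the middle piece whose column dominates the
  head and is strictly dominated by the tail is a renewal index of the whole walk.
* §3 `continuous_Imat_apply`, `Imat_stripYT_le_of_tendsto` (`I_N(y_T) ≤ I_T`), `pow_apply_le_div_of_mulVec_eq` (`A ≥ 0`, `A u = u`, `u > 0`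
  ⇒ `(A^k)_{ab} ≤ u_a/u_b`), ★ `exists_Dk_stripYT_le` — the `k`-piece bridge sums `D^{(k)}_N(a,b)(y_T)` are bounded UNIFORMLY in `k, N`.
* §4 `xiAt_sub_le_of_isChain`, `xiAt_dist_le` (columns are 1-Lipschitz along a walk), ★★ `card_renIdxs_midP_le` — THE COUNTING LEMMA:
  for a list with `sIdx < tIdx` and no renewal index, `#renIdxs (midP l) ≤ sIdx l + (|l| − 1 − t1Idx l)` (every renewal column of
  the middle bridge lies in `(ξ_s, ξ_s + s) ∪ [ξ_{t₁} − (|l|−1−t₁), ξ_{t₁})` by §2 and the Lipschitz property, and renewal columns are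
  distinct); `npieces_midP_succ_le : npieces (xstd (midP l)) + 1 ≤ |headP l| + |xstd (tailP l)|`.
* §5 `noRenA T L` — the case-A β-walks of `S_{T,L}` WITHOUT renewal index (case B never has one and is the mirror image of case A, so
  the renewal split of `B_T` lives on case A); ★ `sum_hBridgesN_npieces_le` (bridges with `< K` pieces weigh `≤ x_c y_T (2T)² C₀ K` at
  `y_T`); ★★★ `exists_sum_noRenA_stripYT_le (hT : 2 ≤ T) : ∃ C, ∀ L, Σ_{ω ∈ noRenA T L} x_c^{|ω|} y_T^{#top ω} ≤ C` — THE NO-RENEWAL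
  CLASS IS SUMMABLE AT THE THRESHOLD, for every width `T ≥ 2`.
NOT claimed: anything about all β-walks without renewal index (not summable), the residue / coefficient law of `B_T` (next modules),
`T = 1`, `T`-uniformity.
-/

noncomputable section

open Finset Filter Topology Matrix Literature.Probability.LatticeModels Literature.Probability.Percolation Literature.Analysis.Matrix

namespace Literature.Probability.RandomPlanarGeometry.SAW

namespace HV

variable {T : ℕ}

/-- ★ **Geometric bound below the growth rate**: if `x_c ν_T(y) < 1` (`T ≥ 1`, `y > 0`) there are `C` and `θ ∈ (0,1)` with
`x_cⁿ Z_{T,n}(y) ≤ C θⁿ` for every `n` (from `Z_{T,n}(y)^{1/n} → ν_T(y)`). [cite: BeatonBousquetMelouDeGierDuminilCopinGuttmann2014, §3.2 Proposition 6 (ν_T(y) = lim Z_{T,n}(y)^{1/n}); lane plumbing] -/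
theorem exists_pow_mul_stripZL_le_geometric (hT : 1 ≤ T) {y : ℝ} (hy : 0 < y) (hν : hexCriticalFugacity * stripNu T y < 1) :
    ∃ C θ : ℝ, 0 < θ ∧ θ < 1 ∧ 0 ≤ C ∧ ∀ n : ℕ, hexCriticalFugacity ^ n * stripZL T n y ≤ C * θ ^ n := by
  have hx := hexCriticalFugacity_pos_lt_one.1
  set θ : ℝ := (hexCriticalFugacity * stripNu T y + 1) / 2 with hθ
  have hθ1 : θ < 1 := by rw [hθ]; linarith
  have hθν : hexCriticalFugacity * stripNu T y < θ := by rw [hθ]; linarith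
  have hθ0 : 0 < θ := lt_trans (mul_pos hx (stripNu_pos hT hy)) hθν
  set ρ := θ / hexCriticalFugacity with hρ
  have hνρ : stripNu T y < ρ := by rw [hρ, lt_div_iff₀ hx, mul_comm]; exact hθν
  have hρx : hexCriticalFugacity * ρ = θ := by rw [hρ]; field_simp
  have h1 := (tendsto_stripZL_rpow hT hy).eventually (gt_mem_nhds hνρ)
  obtain ⟨n₀, hn₀⟩ := eventually_atTop.1 (h1.and (eventually_ge_atTop 1))
  have hpt : ∀ n, n₀ ≤ n → hexCriticalFugacity ^ n * stripZL T n y ≤ θ ^ n := by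
    intro n hn
    obtain ⟨hlt, hn1⟩ := hn₀ n hn
    have hZ0 : 0 ≤ stripZL T n y := stripZL_nonneg T n hy.le
    have hpow : stripZL T n y ≤ ρ ^ n := by
      have h2 : ((stripZL T n y) ^ (1 / (n : ℝ))) ^ (n : ℝ) ≤ ρ ^ (n : ℝ) :=
        Real.rpow_le_rpow (Real.rpow_nonneg hZ0 _) hlt.le (Nat.cast_nonneg n)
      rw [← Real.rpow_mul hZ0, one_div_mul_cancel (by positivity), Real.rpow_one, Real.rpow_natCast] at h2
      exact h2
    calc hexCriticalFugacity ^ n * stripZL T n y ≤ hexCriticalFugacity ^ n * ρ ^ n :=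
          mul_le_mul_of_nonneg_left hpow (pow_nonneg hx.le n)
      _ = θ ^ n := by rw [← mul_pow, hρx]
  -- the finitely many small `n` are absorbed into the constant `C = 1 + Σ_{n<n₀} x_cⁿ Z_n / θⁿ`
  set C : ℝ := 1 + ∑ n ∈ range n₀, hexCriticalFugacity ^ n * stripZL T n y / θ ^ n with hC
  have hCnn : ∀ n, 0 ≤ hexCriticalFugacity ^ n * stripZL T n y / θ ^ n := fun n =>
    div_nonneg (mul_nonneg (pow_nonneg hx.le _) (stripZL_nonneg T n hy.le)) (pow_nonneg hθ0.le _)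
  have hC1 : 1 ≤ C := by rw [hC]; exact le_add_of_nonneg_right (sum_nonneg fun n _ => hCnn n)
  refine ⟨C, θ, hθ0, hθ1, by linarith, fun n => ?_⟩
  by_cases hn : n₀ ≤ n
  · calc hexCriticalFugacity ^ n * stripZL T n y ≤ θ ^ n := hpt n hn
      _ = 1 * θ ^ n := (one_mul _).symm
      _ ≤ C * θ ^ n := mul_le_mul_of_nonneg_right hC1 (pow_nonneg hθ0.le n)
  · have hmem : n ∈ range n₀ := mem_range.2 (by omega)
    have hle : hexCriticalFugacity ^ n * stripZL T n y / θ ^ n ≤ C := by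
      rw [hC]
      have := single_le_sum (f := fun n => hexCriticalFugacity ^ n * stripZL T n y / θ ^ n) (fun n _ => hCnn n) hmem
      linarith
    have hθn : 0 < θ ^ n := pow_pos hθ0 n
    calc hexCriticalFugacity ^ n * stripZL T n y = (hexCriticalFugacity ^ n * stripZL T n y / θ ^ n) * θ ^ n := by
          field_simp
      _ ≤ C * θ ^ n := mul_le_mul_of_nonneg_right hle hθn.le

/-- ★ **First moment below the growth rate**: if `x_c ν_T(y) < 1` then `Σ_{n<M} (n+1) · x_cⁿ Z_{T,n}(y) ≤ C'` uniformly in `M`.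
[cite: BeatonBousquetMelouDeGierDuminilCopinGuttmann2014, §3.2 Proposition 6; lane plumbing] -/
theorem exists_partialSum_succ_mul_stripZL_le (hT : 1 ≤ T) {y : ℝ} (hy : 0 < y) (hν : hexCriticalFugacity * stripNu T y < 1) :
    ∃ C' : ℝ, ∀ M : ℕ, ∑ n ∈ range M, ((n : ℝ) + 1) * (hexCriticalFugacity ^ n * stripZL T n y) ≤ C' := by
  obtain ⟨C, θ, hθ0, hθ1, hC0, hb⟩ := exists_pow_mul_stripZL_le_geometric hT hy hν
  -- `Σ (n+1) θⁿ` converges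
  have hs : Summable fun n : ℕ => ((n : ℝ) + 1) * θ ^ n := by
    have h1 : Summable fun n : ℕ => (n : ℝ) * θ ^ n := by
      simpa using summable_pow_mul_geometric_of_norm_lt_one 1 (by rw [Real.norm_of_nonneg hθ0.le]; exact hθ1)
    have h2 : Summable fun n : ℕ => θ ^ n := summable_geometric_of_lt_one hθ0.le hθ1
    simpa [add_mul] using h1.add h2
  refine ⟨C * ∑' n : ℕ, ((n : ℝ) + 1) * θ ^ n, fun M => ?_⟩
  calc ∑ n ∈ range M, ((n : ℝ) + 1) * (hexCriticalFugacity ^ n * stripZL T n y)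
      ≤ ∑ n ∈ range M, ((n : ℝ) + 1) * (C * θ ^ n) :=
        sum_le_sum fun n _ => mul_le_mul_of_nonneg_left (hb n) (by positivity)
    _ = C * ∑ n ∈ range M, ((n : ℝ) + 1) * θ ^ n := by rw [mul_sum]; exact sum_congr rfl fun n _ => by ring
    _ ≤ C * ∑' n : ℕ, ((n : ℝ) + 1) * θ ^ n :=
        mul_le_mul_of_nonneg_left (hs.sum_le_tsum _ fun n _ => by positivity) hC0

/-- ★ **First moment of the top-free heads**: `Σ_{q ∈ topFreeN T N} |q| · x_c^{|q|−1} ≤ C` uniformly in `N` (`T ≥ 1`) — a top-free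
head of the strip is a chain counted at unit surface fugacity, and `x_c ν_T(1) < 1` because `1 < y_T`. (Blueprint (A)(b): the heads of
the no-renewal class have a finite first moment in length.) [cite: DuminilCopinSmirnov2012, §3 (the strip S_T); BeatonBousquetMelouDeGierDuminilCopinGuttmann2014, §3.2 Proposition 6 and Corollary 8; lane plumbing] -/
theorem exists_topFree_length_mul_le (hT : 1 ≤ T) :
    ∃ C : ℝ, ∀ N, ∑ l ∈ topFreeN T N, (l.length : ℝ) * hexCriticalFugacity ^ (l.length - 1) ≤ C := by
  classical
  have hν : hexCriticalFugacity * stripNu T 1 < 1 := by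
    have h := (stripNu_lt_inv_iff hT one_pos).2 (one_lt_stripYT hT)
    have hx := hexCriticalFugacity_pos_lt_one.1
    calc hexCriticalFugacity * stripNu T 1 < hexCriticalFugacity * hexCriticalFugacity⁻¹ := mul_lt_mul_of_pos_left h hx
      _ = 1 := mul_inv_cancel₀ hx.ne'
  obtain ⟨C, hC⟩ := exists_partialSum_succ_mul_stripZL_le hT one_pos hν
  refine ⟨C, fun N => ?_⟩
  have hx := hexCriticalFugacity_pos_lt_one.1
  calc ∑ l ∈ topFreeN T N, (l.length : ℝ) * hexCriticalFugacity ^ (l.length - 1)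
      ≤ ∑ l ∈ (Finset.range (N + 1)).biUnion fun n => stripChains T n, (l.length : ℝ) * hexCriticalFugacity ^ (l.length - 1) :=
        sum_le_sum_of_subset_of_nonneg (filter_subset _ _) fun l _ _ => mul_nonneg (Nat.cast_nonneg _) (pow_nonneg hx.le _)
    _ = ∑ n ∈ range (N + 1), ∑ l ∈ stripChains T n, (l.length : ℝ) * hexCriticalFugacity ^ (l.length - 1) :=
        sum_biUnion (LinLow.disj_stripChains T _)
    _ = ∑ n ∈ range (N + 1), ((n : ℝ) + 1) * (hexCriticalFugacity ^ n * stripZL T n 1) := by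
        refine sum_congr rfl fun n _ => ?_
        rw [stripZL, mul_sum, mul_sum]
        refine sum_congr rfl fun l hl => ?_
        rw [(mem_stripChains_iff.1 hl).2.2.1, Nat.add_sub_cancel, one_pow, mul_one]
        push_cast; ring
    _ ≤ C := hC _

set_option maxHeartbeats 400000 in
/-- ★ **First moment of the bottom-free tails**: `Σ_{r ∈ botFreeN T N} |r| · x_c^{|r|−1} y^{#top(r.tail)} ≤ C` uniformly in `N`, when
the width-`(T−1)` strip is subcritical at `y` (`x_c ν_{T−1}(y) < 1`, `y ≥ 1`, `T ≥ 2`; at `y = y_T` this is `y_T < y_{T−1}`).  Same route as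
the tree's `exists_botFreeSumN_le` (a bottom-free tail lives, from its third vertex on, in the strip of width `T − 1`: `botSplit`), with
the length carried to the down-shifted tail and the first-moment bound `exists_partialSum_succ_mul_stripZL_le`. (Blueprint (A)(b): the
tails of the no-renewal class have a finite first moment in length.)
[cite: BeatonBousquetMelouDeGierDuminilCopinGuttmann2014, Corollary 8 and (15) (y_T decreases in T); DuminilCopinSmirnov2012, §3; lane plumbing] -/
theorem exists_botFree_length_mul_le (hT : 2 ≤ T) {y : ℝ} (hy1 : 1 ≤ y) (hν : hexCriticalFugacity * stripNu (T - 1) y < 1) :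
    ∃ C : ℝ, ∀ N, ∑ l ∈ botFreeN T N, (l.length : ℝ) * (hexCriticalFugacity ^ (l.length - 1) * y ^ topCnt T l.tail) ≤ C := by
  classical
  have hx := hexCriticalFugacity_pos_lt_one
  have hy0 : 0 < y := by linarith
  have hT1 : 1 ≤ T - 1 := by omega
  obtain ⟨C', hC'⟩ := exists_partialSum_succ_mul_stripZL_le hT1 hy0 hν
  have hC'0 : 0 ≤ C' := le_trans (by simp) (hC' 0)
  set K₀ : ℝ := ((stripChains T 0).card + (stripChains T 1).card : ℕ) * (2 * y) with hK₀
  set K₁ : ℝ := (stripChains T 2).card * (hexCriticalFugacity ^ 2 * y * (4 * C')) with hK₁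
  refine ⟨K₁ + K₀, fun N => ?_⟩
  -- split by length
  set S := botFreeN T N with hS
  rw [← sum_filter_add_sum_filter_not S (fun l => 3 ≤ l.length)]
  refine add_le_add ?_ ?_
  · ------------------------------------------------------------------ long lists (≥ 3 vertices)
    have hmemS : ∀ l ∈ S.filter (fun l => 3 ≤ l.length), ∃ n, l ∈ stripChains T n ∧ l.IsChain hvGraph.Adj ∧ l.Nodup ∧
        l.length = n + 1 ∧ (∃ v, l.head? = some v ∧ v.1 = 0) ∧ InLev T l ∧ 3 ≤ l.length ∧ l ∈ botFreeN T N := by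
      intro l hl
      rw [mem_filter] at hl
      have hl' := hl.1
      rw [hS, botFreeN, mem_filter, mem_biUnion] at hl'
      obtain ⟨⟨n, -, hsc⟩, -, -⟩ := hl'
      obtain ⟨hc, hnd, hlen, hh, hin⟩ := mem_stripChains_iff.1 hsc
      exact ⟨n, hsc, hc, hnd, hlen, hh, hin, hl.2, hS ▸ hl.1⟩
    -- (i) termwise comparison, with the length weight carried to the down-shifted tail (`|l| = |downTail l| + 2`)
    have hle : ∀ l ∈ S.filter (fun l => 3 ≤ l.length),
        (l.length : ℝ) * (hexCriticalFugacity ^ (l.length - 1) * y ^ topCnt T l.tail) ≤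
          (((botSplit l).2.length : ℝ) + 3) * botWt T y (botSplit l) := by
      intro l hl
      obtain ⟨n, -, hc, hnd, hlen, -, -, h3, hbf⟩ := hmemS l hl
      have hlenW : (l.length : ℝ) ≤ ((botSplit l).2.length : ℝ) + 3 := by
        rw [botSplit, downTail, length_xstd, List.length_map, List.length_drop]
        have : l.length ≤ l.length - 2 + 3 := by omega
        exact_mod_cast this
      refine (mul_le_mul_of_nonneg_right hlenW (mul_nonneg (pow_nonneg hx.1.le _) (pow_nonneg hy0.le _))).trans
        (mul_le_mul_of_nonneg_left ?_ (by positivity))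
      have hlenD : (downTail l).length = l.length - 2 := by rw [downTail, length_xstd, List.length_map, List.length_drop]
      have htopD : topCnt (T - 1) (downTail l) = topCnt T (l.drop 2) := by
        rw [downTail, topCnt_xstd, LinLow.topCnt_shift_down (by omega)]
      obtain ⟨a, b, rest, rfl⟩ : ∃ a b rest, l = a :: b :: rest := by
        match l, h3 with
        | a :: b :: rest, _ => exact ⟨a, b, rest, rfl⟩
      have htail : topCnt T (b :: rest) ≤ 1 + topCnt T rest := by
        rw [topCnt_cons]
        split_ifs <;> omega
      simp only [List.drop_succ_cons, List.drop_zero] at htopD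
      rw [botWt, botSplit]
      simp only [hlenD, htopD, List.length_cons, List.tail_cons]
      have hrest : 1 ≤ rest.length := by simp at h3; omega
      have e1 : rest.length + 1 + 1 - 1 = 2 + (rest.length - 1) := by omega
      have e2 : rest.length + 1 + 1 - 2 - 1 = rest.length - 1 := by omega
      rw [e1, e2, pow_add]
      calc hexCriticalFugacity ^ 2 * hexCriticalFugacity ^ (rest.length - 1) * y ^ topCnt T (b :: rest)
          ≤ hexCriticalFugacity ^ 2 * hexCriticalFugacity ^ (rest.length - 1) * y ^ (1 + topCnt T rest) :=
            mul_le_mul_of_nonneg_left (pow_le_pow_right₀ hy1 htail) (mul_nonneg (pow_nonneg hx.1.le _) (pow_nonneg hx.1.le _))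
        _ = hexCriticalFugacity ^ 2 * y * (hexCriticalFugacity ^ (rest.length - 1) * y ^ topCnt T rest) := by
            rw [pow_add, pow_one]; ring
    -- (ii) the image lies in `stripChains T 2 × ⋃_k stripChains (T−1) k`
    set U := (Finset.range (N + 1)).biUnion fun k => stripChains (T - 1) k with hU
    have himg : ∀ l ∈ S.filter (fun l => 3 ≤ l.length), botSplit l ∈ stripChains T 2 ×ˢ U := by
      intro l hl
      obtain ⟨n, hsc, hc, hnd, hlen, ⟨v, hv, hv0⟩, hin, h3, hbf⟩ := hmemS l hl
      have hnN : n ≤ N := by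
        have h' : l ∈ botFreeN T N := hbf
        rw [botFreeN, mem_filter, mem_biUnion] at h'
        obtain ⟨⟨n', hn', hsc'⟩, -⟩ := h'
        have := (mem_stripChains_iff.1 hsc').2.2.1
        rw [mem_range] at hn'; omega
      rw [botSplit, mem_product]
      constructor
      · rw [mem_stripChains_iff]
        refine ⟨hc.take 3, hnd.sublist (List.take_sublist _ _), by rw [List.length_take]; omega, ⟨v, ?_, hv0⟩,
          fun w hw => hin w ((List.take_sublist _ _).subset hw)⟩
        rw [List.head?_take, if_neg (by norm_num), hv]
      · rw [hU, mem_biUnion]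
        refine ⟨l.length - 3, mem_range.2 (by omega), ?_⟩
        rw [mem_stripChains_iff]
        have hne : (l.drop 2).map (shift 0 (-1)) ≠ [] := by simp [List.drop_eq_nil_iff]; omega
        have hcD : ((l.drop 2).map (shift 0 (-1))).IsChain hvGraph.Adj := by
          rw [List.isChain_map]; exact (hc.drop 2).imp fun a b hab => (shift _ _).map_rel_iff.2 hab
        have hw := List.head?_eq_some_head hne
        set w := ((l.drop 2).map (shift 0 (-1))).head hne
        refine ⟨isChain_xstd hcD, nodup_xstd ((hnd.sublist (List.drop_sublist _ _)).map (shift _ _).injective),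
          by rw [downTail, length_xstd, List.length_map, List.length_drop]; omega, ⟨(0, w.2.1, w.2.2), head?_xstd hw, rfl⟩,
          inLev_xstd fun u hu => ?_⟩
        rw [List.mem_map] at hu
        obtain ⟨u', hu', rfl⟩ := hu
        have h2 := two_le_lev_of_mem_drop_two hT hbf hu'
        have hup := (hin u' ((List.drop_sublist _ _).subset hu')).2
        rw [LinLow.lev_shift_down]
        have hc' : ((T - 1 : ℕ) : ℤ) = (T : ℤ) - 1 := by push_cast [Nat.cast_sub (show 1 ≤ T by omega)]; ring
        rw [hc']
        constructor <;> omega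
    -- (iii) injectivity
    have hinj : Set.InjOn botSplit (S.filter (fun l => 3 ≤ l.length) : Set (List HV)) := by
      intro l hl l' hl' heq
      obtain ⟨-, -, -, -, -, -, -, h3, -⟩ := hmemS l hl
      obtain ⟨-, -, -, -, -, -, -, h3', -⟩ := hmemS l' hl'
      simp only [botSplit, Prod.mk.injEq] at heq
      obtain ⟨htk, hdt⟩ := heq
      have h2' : l[2]? = l'[2]? := by
        have := congrArg (fun t : List HV => t[2]?) htk
        simpa [List.getElem?_take] using this
      have h2 : l[2]'(by omega) = l'[2]'(by omega) := by
        rw [List.getElem?_eq_getElem (show 2 < l.length by omega), List.getElem?_eq_getElem (show 2 < l'.length by omega),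
          Option.some.injEq] at h2'
        exact h2'
      have hhead : ((l.drop 2).map (shift 0 (-1))).head? = ((l'.drop 2).map (shift 0 (-1))).head? := by
        rw [List.head?_map, List.head?_map, List.head?_drop, List.head?_drop, List.getElem?_eq_getElem (by omega),
          List.getElem?_eq_getElem (by omega), h2]
      have hL : (l.drop 2).map (shift 0 (-1)) = (l'.drop 2).map (shift 0 (-1)) := xstd_inj_of_head hdt hhead
      have hdrop : l.drop 2 = l'.drop 2 := (List.map_injective_iff.2 (shift _ _).injective) hL
      have htake : l.take 2 = l'.take 2 := by
        have := congrArg (fun t : List HV => t.take 2) htk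
        simpa [List.take_take] using this
      rw [← List.take_append_drop 2 l, ← List.take_append_drop 2 l', htake, hdrop]
    -- (iv) sum over the product
    calc ∑ l ∈ S.filter (fun l => 3 ≤ l.length), (l.length : ℝ) * (hexCriticalFugacity ^ (l.length - 1) * y ^ topCnt T l.tail)
        ≤ ∑ l ∈ S.filter (fun l => 3 ≤ l.length), ((((botSplit l).2.length : ℝ) + 3) * botWt T y (botSplit l)) := sum_le_sum hle
      _ = ∑ pm ∈ (S.filter (fun l => 3 ≤ l.length)).image botSplit, ((pm.2.length : ℝ) + 3) * botWt T y pm :=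
          (sum_image (f := fun pm : List HV × List HV => ((pm.2.length : ℝ) + 3) * botWt T y pm) hinj).symm
      _ ≤ ∑ pm ∈ stripChains T 2 ×ˢ U, ((pm.2.length : ℝ) + 3) * botWt T y pm := by
          refine sum_le_sum_of_subset_of_nonneg (fun pm hpm => ?_) fun pm _ _ => mul_nonneg (by positivity)
            (mul_nonneg (mul_nonneg (pow_nonneg hx.1.le 2) hy0.le) (mul_nonneg (pow_nonneg hx.1.le _) (pow_nonneg hy0.le _)))
          rw [mem_image] at hpm
          obtain ⟨l, hl, rfl⟩ := hpm
          exact himg l hl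
      _ = (stripChains T 2).card * (hexCriticalFugacity ^ 2 * y *
            ∑ m ∈ U, ((m.length : ℝ) + 3) * (hexCriticalFugacity ^ (m.length - 1) * y ^ topCnt (T - 1) m)) := by
          rw [sum_product]
          have hconst : ∀ x ∈ stripChains T 2, ∑ m ∈ U, ((m.length : ℝ) + 3) * botWt T y (x, m) =
              hexCriticalFugacity ^ 2 * y * ∑ m ∈ U, ((m.length : ℝ) + 3) * (hexCriticalFugacity ^ (m.length - 1) * y ^ topCnt (T - 1) m) :=
            fun x _ => by rw [mul_sum]; exact sum_congr rfl fun m _ => by rw [botWt]; ring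
          rw [sum_congr rfl hconst, sum_const, nsmul_eq_mul]
      _ ≤ K₁ := by
          rw [hK₁]
          refine mul_le_mul_of_nonneg_left (mul_le_mul_of_nonneg_left ?_ (by positivity)) (Nat.cast_nonneg _)
          rw [hU, sum_biUnion (LinLow.disj_stripChains (T - 1) _)]
          calc ∑ k ∈ range (N + 1), ∑ m ∈ stripChains (T - 1) k, ((m.length : ℝ) + 3) * (hexCriticalFugacity ^ (m.length - 1) * y ^ topCnt (T - 1) m)
              = ∑ k ∈ range (N + 1), ((k : ℝ) + 4) * (hexCriticalFugacity ^ k * stripZL (T - 1) k y) := by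
                refine sum_congr rfl fun k _ => ?_
                rw [stripZL, mul_sum, mul_sum]
                refine sum_congr rfl fun m hm => ?_
                rw [(mem_stripChains_iff.1 hm).2.2.1, Nat.add_sub_cancel]
                push_cast; ring
            _ ≤ ∑ k ∈ range (N + 1), 4 * (((k : ℝ) + 1) * (hexCriticalFugacity ^ k * stripZL (T - 1) k y)) :=
                sum_le_sum fun k _ => by
                  have h0 : 0 ≤ hexCriticalFugacity ^ k * stripZL (T - 1) k y :=
                    mul_nonneg (pow_nonneg hx.1.le _) (stripZL_nonneg (T - 1) k hy0.le)
                  have hk : (0 : ℝ) ≤ k := Nat.cast_nonneg k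
                  nlinarith
            _ = 4 * ∑ k ∈ range (N + 1), ((k : ℝ) + 1) * (hexCriticalFugacity ^ k * stripZL (T - 1) k y) := by rw [mul_sum]
            _ ≤ 4 * C' := by linarith [hC' (N + 1)]
  · ------------------------------------------------------------------ short lists (≤ 2 vertices)
    calc ∑ l ∈ S.filter (fun l => ¬ 3 ≤ l.length), (l.length : ℝ) * (hexCriticalFugacity ^ (l.length - 1) * y ^ topCnt T l.tail)
        ≤ ∑ l ∈ S.filter (fun l => ¬ 3 ≤ l.length), 2 * y := by
          refine sum_le_sum fun l hl => ?_
          rw [mem_filter] at hl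
          have hlt : topCnt T l.tail ≤ 1 := (topCnt_le_length T _).trans (by rw [List.length_tail]; omega)
          have hlen2 : (l.length : ℝ) ≤ 2 := by exact_mod_cast (show l.length ≤ 2 by omega)
          calc (l.length : ℝ) * (hexCriticalFugacity ^ (l.length - 1) * y ^ topCnt T l.tail) ≤ 2 * (1 * y ^ 1) :=
                mul_le_mul hlen2 (mul_le_mul (pow_le_one₀ hx.1.le hx.2.le) (pow_le_pow_right₀ hy1 hlt) (pow_nonneg hy0.le _) zero_le_one)
                  (mul_nonneg (pow_nonneg hx.1.le _) (pow_nonneg hy0.le _)) (by norm_num)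
            _ = 2 * y := by rw [one_mul, pow_one]
      _ = ((S.filter fun l => ¬ 3 ≤ l.length).card : ℝ) * (2 * y) := by rw [sum_const, nsmul_eq_mul]
      _ ≤ K₀ := by
          rw [hK₀]
          refine mul_le_mul_of_nonneg_right ?_ (by linarith)
          have hsub : S.filter (fun l => ¬ 3 ≤ l.length) ⊆ stripChains T 0 ∪ stripChains T 1 := by
            intro l hl
            rw [mem_filter, hS, botFreeN, mem_filter, mem_biUnion] at hl
            obtain ⟨⟨⟨n, -, hsc⟩, -, -⟩, hlen3⟩ := hl
            have hlen := (mem_stripChains_iff.1 hsc).2.2.1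
            rw [mem_union]
            rcases Nat.lt_or_ge n 1 with h | h
            · left
              have hn0 : n = 0 := by omega
              subst hn0; exact hsc
            · right
              have hn1 : n = 1 := by omega
              subst hn1; exact hsc
          exact_mod_cast (card_le_card hsub).trans (card_union_le _ _)


/-! ### §2 The KEY LEMMA of the blueprint: renewal indices of the middle piece lift to the whole walk -/

/-- ★ **Renewal indices of a middle segment lift** (blueprint (A)(a), KEY LEMMA): let `s < i < t < |l|`; if `i − s` is a renewal index
of the segment `l[s .. t]`, every vertex up to `s` has column `≤ ξ_i`, and every vertex from `t` on has column `> ξ_i`, then `i` is a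
renewal index of `l`.  (Contrapositive: a walk WITHOUT renewal indices has no renewal index of its middle bridge whose column lies in the
window `[max column of the head, min column of the tail)`.) [cite: DuminilCopinHammond2013, §2.2 (renewal points); lane plumbing] -/
theorem isRenewalIdx_of_segment {l : List HV} {s t i : ℕ} (ht : t < l.length) (hsi : s < i) (hit : i < t)
    (hmid : IsRenewalIdx ((l.take (t + 1)).drop s) (i - s))
    (hhead : ∀ j, j ≤ s → xiAt l j ≤ xiAt l i) (htail : ∀ j, t ≤ j → j < l.length → xiAt l i < xiAt l j) :
    IsRenewalIdx l i := by
  obtain ⟨-, -, hm3, hm4⟩ := hmid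
  -- columns of the segment are columns of `l`
  have hseg : ∀ k, s + k < t + 1 → xiAt ((l.take (t + 1)).drop s) k = xiAt l (s + k) := fun k hk => by
    rw [xiAt_drop, xiAt_take hk]
  have hlen : ((l.take (t + 1)).drop s).length = t + 1 - s := by
    rw [List.length_drop, List.length_take, min_eq_left (by omega)]
  have hii : xiAt ((l.take (t + 1)).drop s) (i - s) = xiAt l i := by
    rw [hseg (i - s) (by omega)]; congr 1; omega
  refine ⟨by omega, by omega, fun j hj => ?_, fun j hj hij => ?_⟩
  · rw [mem_range] at hj
    rcases Nat.lt_or_ge s j with hsj | hjs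
    · -- `s < j ≤ i`: inside the segment
      have h := hm3 (j - s) (mem_range.2 (by omega))
      rw [hii, hseg (j - s) (by omega), show s + (j - s) = j by omega] at h
      exact h
    · exact hhead j hjs
  · rw [mem_range] at hj
    rcases Nat.lt_or_ge j t with hjt | htj
    · -- `i < j < t`: inside the segment
      have h := hm4 (j - s) (mem_range.2 (by rw [hlen]; omega)) (by omega)
      rw [hii, hseg (j - s) (by omega), show s + (j - s) = j by omega] at h
      exact h
    · exact htail j htj hj

/-- ★ The KEY LEMMA in the `decTriple` setting: for a list with `sIdx < tIdx`, a renewal index of the standardised middle piece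
`xstd (midP l)` whose column dominates the head and is dominated strictly by the tail is a renewal index of the whole list.
[cite: DuminilCopinHammond2013, §2.2; lane plumbing] -/
theorem isRenewalIdx_of_midP {l : List HV} (hl : l ≠ []) (hst : sIdx l < tIdx l) {i : ℕ} (hsi : sIdx l < i) (hit : i < t1Idx l)
    (hmid : IsRenewalIdx (xstd (midP l)) (i - sIdx l))
    (hhead : ∀ j, j ≤ sIdx l → xiAt l j ≤ xiAt l i) (htail : ∀ j, t1Idx l ≤ j → j < l.length → xiAt l i < xiAt l j) :
    IsRenewalIdx l i := by
  obtain ⟨-, -, ht, -, -⟩ := t1Idx_spec hl hst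
  rw [xstd, isRenewalIdx_map_shift] at hmid
  exact isRenewalIdx_of_segment ht hsi hit hmid hhead htail

/-! ### §3 Powers of the limit kernel are bounded: the `k`-piece bridge sums at the threshold, uniformly in `k` -/

/-- The truncated irreducible-bridge matrix entry `I_N(y)_{ab}` is continuous in `y` (a polynomial with non-negative coefficients).
[cite: DuminilCopinHammond2013, §2.2; lane plumbing] -/
theorem continuous_Imat_apply (N : ℕ) (a b : Fin (2 * T)) : Continuous fun y : ℝ => Imat T N y a b := by
  unfold Imat Dk wD
  exact continuous_finsetSum _ fun l _ => continuous_const.mul (continuous_pow _)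

/-- At the threshold, every truncation lies below the limit kernel: `I_N(y_T)_{ab} ≤ (I_T)_{ab}` whenever `I(y) → I_T` as `y ↑ y_T`
(`T ≥ 1`). [cite: DuminilCopinHammond2013, §2.2; Seneta1973, Chapter 6; lane plumbing] -/
theorem Imat_stripYT_le_of_tendsto (hT : 1 ≤ T) {IT : Matrix (Fin (2 * T)) (Fin (2 * T)) ℝ}
    (hI : ∀ a b, Tendsto (fun y => Iinf T y a b) (𝓝[<] stripYT T) (𝓝 (IT a b))) (N : ℕ) (a b : Fin (2 * T)) :
    Imat T N (stripYT T) a b ≤ IT a b := by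
  have h1 : Tendsto (fun y => Imat T N y a b) (𝓝[<] stripYT T) (𝓝 (Imat T N (stripYT T) a b)) :=
    ((continuous_Imat_apply N a b).tendsto _).mono_left nhdsWithin_le_nhds
  refine le_of_tendsto_of_tendsto h1 (hI a b) ?_
  filter_upwards [Ico_mem_nhdsLT (one_lt_stripYT hT)] with y hy
  exact Imat_le_Iinf hT hy N a b

/-- The limit kernel is entrywise non-negative. [cite: Seneta1973, Chapter 6; lane plumbing] -/
theorem IT_nonneg_of_tendsto (hT : 1 ≤ T) {IT : Matrix (Fin (2 * T)) (Fin (2 * T)) ℝ}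
    (hI : ∀ a b, Tendsto (fun y => Iinf T y a b) (𝓝[<] stripYT T) (𝓝 (IT a b))) (a b : Fin (2 * T)) : 0 ≤ IT a b := by
  refine ge_of_tendsto (hI a b) ?_
  filter_upwards [Ico_mem_nhdsLT (one_lt_stripYT hT)] with y hy
  exact Iinf_nonneg hT hy a b

/-- A non-negative matrix with a positive right fixed vector `A u = u` has bounded powers: `(A^k)_{ab} ≤ u_a / u_b`.
[cite: Seneta1973, Chapter 6 (R-positivity: sub-invariant vectors bound the powers); lane plumbing] -/
theorem pow_apply_le_div_of_mulVec_eq {ι : Type*} [Fintype ι] [DecidableEq ι] {A : Matrix ι ι ℝ} (hA : ∀ a b, 0 ≤ A a b)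
    {u : ι → ℝ} (hu0 : ∀ a, 0 < u a) (hu : A *ᵥ u = u) (k : ℕ) (a b : ι) : (A ^ k) a b ≤ u a / u b := by
  have hk : (A ^ k) *ᵥ u = u := by
    induction k with
    | zero => simp
    | succ k ih => rw [pow_succ, ← Matrix.mulVec_mulVec, hu, ih]
  have h1 : (A ^ k) a b * u b ≤ u a := by
    have h := congrFun hk a
    rw [Matrix.mulVec, dotProduct] at h
    rw [← h]
    exact single_le_sum (f := fun c => (A ^ k) a c * u c) (fun c _ => mul_nonneg (nonnegMat_pow_apply_nonneg hA k a c) (hu0 c).le)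
      (mem_univ b)
  rw [le_div_iff₀ (hu0 b)]
  exact h1

/-- ★ **The `k`-piece bridge sums are bounded at the threshold, uniformly in `k` and in the truncation** (`T ≥ 2`): there is `C₀`
with `D^{(k)}_N(a,b)(y_T) ≤ C₀` for all `N, k, a, b` — since `D^{(k)}_N(y_T) ≤ I_N(y_T)^k ≤ I_T^k` and `I_T u = u` with `u > 0`
(the residue theorem's right vector). [cite: DuminilCopinHammond2013, §2.2; Seneta1973, Chapter 6; lane «pcv-sawmu» a-p2 g20 — own plumbing over the tree's residue theorem] -/
theorem exists_Dk_stripYT_le (hT : 2 ≤ T) : ∃ C₀ : ℝ, 0 ≤ C₀ ∧ ∀ (N k : ℕ) (a b : Fin (2 * T)), Dk T N k (a : ℕ) (b : ℕ) (stripYT T) ≤ C₀ := by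
  have hT1 : 1 ≤ T := by omega
  have hyT0 : 0 ≤ stripYT T := by linarith [one_lt_stripYT hT1]
  obtain ⟨IT, u, ℓ, ρ, hI, hu0, -, hu, -, -, -⟩ := exists_tendsto_bridgeKernel_residue hT
  have hIT0 := IT_nonneg_of_tendsto hT1 hI
  set C₀ : ℝ := (∑ a, u a) * ∑ b, (u b)⁻¹ with hC₀
  have hsum0 : 0 ≤ ∑ a, u a := sum_nonneg fun a _ => (hu0 a).le
  have hsum1 : 0 ≤ ∑ b, (u b)⁻¹ := sum_nonneg fun b _ => (inv_pos.2 (hu0 b)).le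
  have hdiv : ∀ a b, u a / u b ≤ C₀ := fun a b => by
    rw [hC₀, div_eq_mul_inv]
    exact mul_le_mul (single_le_sum (f := u) (fun c _ => (hu0 c).le) (mem_univ a))
      (single_le_sum (f := fun c => (u c)⁻¹) (fun c _ => (inv_pos.2 (hu0 c)).le) (mem_univ b)) (inv_pos.2 (hu0 b)).le hsum0
  refine ⟨C₀, mul_nonneg hsum0 hsum1, fun N k a b => ?_⟩
  rcases Nat.eq_zero_or_pos k with rfl | hk
  · -- no bridge has zero pieces
    have h0 : HBk T N 0 (a : ℕ) (b : ℕ) = ∅ := by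
      rw [HBk, Finset.filter_eq_empty_iff]
      intro l _ h
      rw [npieces] at h
      omega
    rw [Dk, h0, sum_empty]
    exact le_trans (div_nonneg (hu0 a).le (hu0 b).le) (hdiv a b)
  · calc Dk T N k (a : ℕ) (b : ℕ) (stripYT T) = Dmat T N k (stripYT T) a b := rfl
      _ ≤ (Imat T N (stripYT T) ^ k) a b := Dmat_le_pow hyT0 k hk a b
      _ ≤ (IT ^ k) a b := nonnegMat_pow_apply_mono (fun a b => (Imat_Dmat_nonneg (k := k) hyT0 a b).1)
          (fun a b => Imat_stripYT_le_of_tendsto hT1 hI N a b) k a b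
      _ ≤ u a / u b := pow_apply_le_div_of_mulVec_eq hIT0 hu0 hu k a b
      _ ≤ C₀ := hdiv a b


/-! ### §4 Counting the renewal columns of the middle bridge of a walk without renewal points -/

section Counting

variable {l : List HV}

/-- Columns are 1-Lipschitz along a lattice walk: `|ξ(l[i+k]) − ξ(l[i])| ≤ k`. [cite: Beaton2014RotatedHoneycomb, §2 (Fig. 1(b): ξ changes by 0 or ±1 along an edge); lane plumbing] -/
theorem xiAt_sub_le_of_isChain (hc : l.IsChain hvGraph.Adj) {i k : ℕ} (hk : i + k < l.length) :
    xiAt l (i + k) - xiAt l i ≤ k ∧ xiAt l i - xiAt l (i + k) ≤ k := by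
  induction k with
  | zero => simp
  | succ k ih =>
    have ih' := ih (by omega)
    have hadj : hvGraph.Adj (l[i + k]'(by omega)) (l[i + (k + 1)]'hk) := by
      have := List.isChain_iff_getElem.1 hc (i + k) (by omega)
      simpa [Nat.add_assoc] using this
    have h1 := abs_xi_sub_xi_le_one_of_adj hadj
    rw [← xiAt_eq_xi_getElem, ← xiAt_eq_xi_getElem] at h1
    push_cast
    omega

/-- Columns of the middle piece are columns of the walk: `ξ(midP l)[k] = ξ l[s + k]`. [cite: DuminilCopinHammond2013, §2.2 (bridge decomposition: bookkeeping of indices and pieces); lane plumbing] -/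
theorem xiAt_midP {k : ℕ} (hk : sIdx l + k ≤ t1Idx l) : xiAt (midP l) k = xiAt l (sIdx l + k) := by
  rw [midP, xiAt_drop, xiAt_take (by omega)]

/-- Columns are 1-Lipschitz along a lattice walk (two-index form). [cite: Beaton2014RotatedHoneycomb, §2 (Fig. 1(b)); lane plumbing] -/
theorem xiAt_dist_le (hc : l.IsChain hvGraph.Adj) {i j : ℕ} (hij : i ≤ j) (hj : j < l.length) :
    xiAt l j - xiAt l i ≤ (j : ℤ) - i ∧ xiAt l i - xiAt l j ≤ (j : ℤ) - i := by
  have h := xiAt_sub_le_of_isChain hc (i := i) (k := j - i) (by omega)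
  rw [show i + (j - i) = j by omega] at h
  have e : ((j - i : ℕ) : ℤ) = (j : ℤ) - i := by omega
  rw [e] at h
  exact h

/-- Renewal indices have pairwise distinct (indeed increasing) columns. [cite: DuminilCopinHammond2013, §2.2 (renewal points)] -/
theorem xiAt_lt_of_isRenewalIdx {l : List HV} {k k' : ℕ} (hk : IsRenewalIdx l k) (hk'l : k' < l.length) (hkk' : k < k') :
    xiAt l k < xiAt l k' :=
  hk.2.2.2 k' (mem_range.2 hk'l) hkk'

/-- ★ **Counting lemma.**  For a nonempty list with `sIdx < tIdx` and NO renewal index, the middle piece `midP l = l[s .. t₁]` has at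
most `s + (|l| − 1 − t₁)` renewal indices: by the KEY LEMMA every renewal column `c` of the middle piece satisfies `c < ξ_j` for some
`j ≤ s` or `ξ_j ≤ c` for some `j ≥ t₁`; columns move by at most one per step, so `c ∈ (m₀, m₀ + s) ∪ [M − (|l|−1−t₁), M)`
(`m₀ = ξ_s` the minimal, `M = ξ_{t₁}` the maximal column), and renewal columns are distinct.
[cite: DuminilCopinHammond2013, §2.2 (renewal points); lane «pcv-sawmu» a-p2 g20 — own] -/
theorem card_renIdxs_midP_le (hc : l.IsChain hvGraph.Adj) (hl : l ≠ []) (hst : sIdx l < tIdx l) (hno : renIdxs l = ∅) :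
    (renIdxs (midP l)).card ≤ sIdx l + (l.length - 1 - t1Idx l) := by
  classical
  obtain ⟨hs1, -, ht1l, hmax1, -⟩ := t1Idx_spec hl hst
  obtain ⟨hsl, hmin, -⟩ := sIdx_spec hl
  set s := sIdx l with hs
  set t₁ := t1Idx l with ht
  set μ := midP l with hμ
  have hlenμ : μ.length = t₁ + 1 - s := (length_pieces hl hst).2.1
  set d : ℕ := l.length - 1 - t₁ with hd
  -- no index of `l` is a renewal index
  have hnot : ∀ i, i < l.length → ¬ IsRenewalIdx l i := by
    intro i hi h
    have : i ∈ renIdxs l := mem_filter.2 ⟨mem_range.2 hi, h⟩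
    rw [hno] at this
    simp at this
  -- the column map is injective on the renewal indices of `μ`
  have hinj : Set.InjOn (xiAt μ) (renIdxs μ : Set ℕ) := by
    intro k hk k' hk' heq
    rw [mem_coe, renIdxs, mem_filter, mem_range] at hk hk'
    by_contra hne
    rcases lt_or_gt_of_ne hne with h | h
    · exact absurd heq (xiAt_lt_of_isRenewalIdx hk.2 hk'.1 h).ne
    · exact absurd heq.symm (xiAt_lt_of_isRenewalIdx hk'.2 hk.1 h).ne
  -- the image lies in two short intervals
  have himg : (renIdxs μ).image (xiAt μ) ⊆ Finset.Ioo (xiAt l s) (xiAt l s + s) ∪ Finset.Ico (xiAt l t₁ - d) (xiAt l t₁) := by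
    intro c hc'
    rw [mem_image] at hc'
    obtain ⟨k, hk, rfl⟩ := hc'
    rw [renIdxs, mem_filter, mem_range] at hk
    obtain ⟨hkμ, hren⟩ := hk
    obtain ⟨hk0, hk1, hbef, haft⟩ := hren
    set i := s + k with hi
    have hit : i < t₁ := by omega
    have hsi : s < i := by omega
    have hci : xiAt μ k = xiAt l i := xiAt_midP (by omega)
    -- `m₀ < c < M`
    have hlow : xiAt l s < xiAt l i := xiAt_sIdx_lt hl (by omega) hsi
    have hupp : xiAt l i < xiAt l t₁ := by
      have h1 := haft (k + 1) (mem_range.2 hk1) (by omega)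
      rw [hci, xiAt_midP (by omega), show s + (k + 1) = i + 1 by omega] at h1
      exact lt_of_lt_of_le h1 (hmax1 (i + 1) (by omega))
    -- the KEY LEMMA, contrapositive
    have hkey : (∃ j, j ≤ s ∧ xiAt l i < xiAt l j) ∨ (∃ j, t₁ ≤ j ∧ j < l.length ∧ xiAt l j ≤ xiAt l i) := by
      by_contra hcon
      push Not at hcon
      have hmid : IsRenewalIdx ((l.take (t₁ + 1)).drop s) (i - s) := by
        rw [show i - s = k by omega]; exact ⟨hk0, hk1, hbef, haft⟩
      exact hnot i (by omega) (isRenewalIdx_of_segment ht1l hsi hit hmid (fun j hj => hcon.1 j hj) fun j hj hjl => hcon.2 j hj hjl)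
    rw [hci, mem_union, Finset.mem_Ioo, Finset.mem_Ico]
    rcases hkey with ⟨j, hjs, hlt⟩ | ⟨j, htj, hjl, hle⟩
    · left
      refine ⟨hlow, ?_⟩
      have hL := (xiAt_dist_le hc hjs hsl).2
      omega
    · right
      refine ⟨?_, hupp⟩
      have hL := (xiAt_dist_le hc htj hjl).2
      have hdj : (j : ℤ) - t₁ ≤ d := by rw [hd]; omega
      omega
  calc (renIdxs μ).card = ((renIdxs μ).image (xiAt μ)).card := (card_image_of_injOn hinj).symm
    _ ≤ (Finset.Ioo (xiAt l s) (xiAt l s + s) ∪ Finset.Ico (xiAt l t₁ - d) (xiAt l t₁)).card := card_le_card himg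
    _ ≤ (Finset.Ioo (xiAt l s) (xiAt l s + s)).card + (Finset.Ico (xiAt l t₁ - d) (xiAt l t₁)).card := card_union_le _ _
    _ ≤ s + d := by
        rw [Int.card_Ioo, Int.card_Ico]
        have h1 : (xiAt l s + s - xiAt l s - 1 : ℤ).toNat ≤ s := Int.toNat_le.2 (by omega)
        have h2 : (xiAt l t₁ - (xiAt l t₁ - d) : ℤ).toNat ≤ d := Int.toNat_le.2 (by omega)
        omega

/-- ★ Hence the standardised middle piece of such a walk has at most `|headP| − 1 + |tailP|` irreducible pieces:
`npieces (xstd (midP l)) + 1 ≤ |headP l| + |tailP l|`. [cite: DuminilCopinHammond2013, §2.2; lane «pcv-sawmu» a-p2 g20 — own] -/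
theorem npieces_midP_succ_le (hc : l.IsChain hvGraph.Adj) (hl : l ≠ []) (hst : sIdx l < tIdx l) (hno : renIdxs l = ∅) :
    npieces (xstd (midP l)) + 1 ≤ (headP l).length + (xstd (tailP l)).length := by
  obtain ⟨hs1, -, ht1l, -, -⟩ := t1Idx_spec hl hst
  obtain ⟨h1, -, h3⟩ := length_pieces hl hst
  rw [npieces_xstd, length_xstd, h1, h3, npieces]
  have := card_renIdxs_midP_le hc hl hst hno
  omega

end Counting


/-! ### §5 ★★★ The case-A β-walks WITHOUT renewal index are summable at the threshold `y_T` -/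

section NoRenewal

/-- **The no-renewal class** `N₀^A(S_{T,L})`: the β-walks of `S_{T,L}` of case A (the last leftmost visit comes before the last
rightmost visit) that have NO renewal index.  (Case-B walks never have a renewal index and weigh exactly as much as case A by
the mirror, so "all β-walks without renewal index" is NOT a summable class; the renewal split of the β-series lives on case A.)
[cite: DuminilCopinHammond2013, §2.2 (renewal points); DuminilCopinSmirnov2012, §3 (walks a → β of S_{T,L}); lane «pcv-sawmu» a-p2 g20] -/
def noRenA (T L : ℕ) : Finset (List HV) := (caseA T L).filter fun l => renIdxs l = ∅

/-- ★ **Bridges with few pieces are uniformly summable at the threshold**: the standard horizontal bridges of `S_T` (any length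
`≤ N + 1`, at least two vertices) with at most `K − 1` irreducible pieces weigh at most `x_c y_T (2T)² C₀ · K` at `y = y_T`, where
`C₀` bounds every `k`-piece level sum (`exists_Dk_stripYT_le`). [cite: DuminilCopinHammond2013, §2.2; lane «pcv-sawmu» a-p2 g20 — own] -/
theorem sum_hBridgesN_npieces_le (hT : 2 ≤ T) {C₀ : ℝ} (hC₀ : ∀ (N k : ℕ) (a b : Fin (2 * T)), Dk T N k (a : ℕ) (b : ℕ) (stripYT T) ≤ C₀)
    (N K : ℕ) :
    ∑ h ∈ (hBridgesN T N).filter (fun h => 2 ≤ h.length ∧ npieces h + 1 ≤ K),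
        hexCriticalFugacity ^ h.length * stripYT T ^ topCnt T h ≤
      hexCriticalFugacity * stripYT T * ((Fintype.card (Fin (2 * T) × Fin (2 * T)) : ℝ) * C₀) * K := by
  classical
  have hx := hexCriticalFugacity_pos_lt_one
  have hT1 : 1 ≤ T := by omega
  have hy1 : (1 : ℝ) ≤ stripYT T := (one_lt_stripYT hT1).le
  have hy0 : (0 : ℝ) ≤ stripYT T := by linarith
  set y := stripYT T with hy
  set F := (hBridgesN T N).filter (fun h => 2 ≤ h.length ∧ npieces h + 1 ≤ K) with hF
  -- termwise `x_c^{|l|} y^{top l} ≤ x_c y · wD(l)` (as in the tree's `hBridgeSumN_le_aux`)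
  have hterm : ∀ l ∈ F, hexCriticalFugacity ^ l.length * y ^ topCnt T l ≤ hexCriticalFugacity * y * wD T y l := by
    intro l hl
    rw [hF, mem_filter] at hl
    obtain ⟨-, -, -, -, -, ⟨hne, -⟩⟩ := mem_hBridgesN_iff.1 hl.1
    obtain ⟨v, t, rfl⟩ := List.exists_cons_of_ne_nil hne
    rw [wD, topCnt_cons, List.length_cons, List.tail_cons, Nat.add_sub_cancel, pow_succ, pow_add]
    have h1 : y ^ (if lev v = 2 * (T : ℤ) - 1 then 1 else 0) ≤ y := by split_ifs <;> simp [hy1]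
    have h2 : 0 ≤ hexCriticalFugacity ^ t.length := pow_nonneg hx.1.le _
    have h3 : 0 ≤ y ^ topCnt T t := pow_nonneg hy0 _
    calc hexCriticalFugacity ^ t.length * hexCriticalFugacity * (y ^ (if lev v = 2 * (T : ℤ) - 1 then 1 else 0) * y ^ topCnt T t)
        ≤ hexCriticalFugacity ^ t.length * hexCriticalFugacity * (y * y ^ topCnt T t) :=
          mul_le_mul_of_nonneg_left (mul_le_mul_of_nonneg_right h1 h3) (mul_nonneg h2 hx.1.le)
      _ = hexCriticalFugacity * y * (hexCriticalFugacity ^ t.length * y ^ topCnt T t) := by ring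
  -- the level-and-pieces classes are pairwise disjoint
  have hdisj : Set.PairwiseDisjoint (↑((univ : Finset (Fin (2 * T) × Fin (2 * T))) ×ˢ range K) :
      Set ((Fin (2 * T) × Fin (2 * T)) × ℕ)) fun abk => HBk T N abk.2 (abk.1.1 : ℕ) (abk.1.2 : ℕ) := by
    intro abk _ abk' _ hne
    rw [Function.onFun, disjoint_left]
    intro l hl hl'
    rw [HBk, mem_filter] at hl hl'
    apply hne
    refine Prod.ext (Prod.ext (Fin.ext ?_) (Fin.ext ?_)) ?_
    · have := hl.2.2.2.1.symm.trans hl'.2.2.2.1; exact_mod_cast this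
    · have := hl.2.2.2.2.symm.trans hl'.2.2.2.2; exact_mod_cast this
    · exact hl.2.2.1.symm.trans hl'.2.2.1
  calc ∑ l ∈ F, hexCriticalFugacity ^ l.length * y ^ topCnt T l ≤ ∑ l ∈ F, hexCriticalFugacity * y * wD T y l :=
        sum_le_sum hterm
    _ = hexCriticalFugacity * y * ∑ l ∈ F, wD T y l := by rw [mul_sum]
    _ ≤ hexCriticalFugacity * y * ∑ l ∈ ((univ : Finset (Fin (2 * T) × Fin (2 * T))) ×ˢ range K).biUnion
          (fun abk => HBk T N abk.2 (abk.1.1 : ℕ) (abk.1.2 : ℕ)), wD T y l := by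
        refine mul_le_mul_of_nonneg_left ?_ (mul_nonneg hx.1.le hy0)
        refine sum_le_sum_of_subset_of_nonneg (fun l hl => ?_) fun _ _ _ => wD_nonneg T hy0 _
        rw [hF, mem_filter] at hl
        obtain ⟨hl, h2, hK⟩ := hl
        have hne : l ≠ [] := List.ne_nil_of_length_pos (by omega)
        obtain ⟨b1, b2, b3, b4⟩ := hdLev_ltLev_bounds (mem_hBridgesN_iff.1 hl).2.2.2.2.1 hne
        rw [mem_biUnion]
        refine ⟨((⟨(hdLev l).toNat, by omega⟩, ⟨(ltLev l).toNat, by omega⟩), npieces l),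
          mem_product.2 ⟨mem_univ _, mem_range.2 (by omega)⟩, ?_⟩
        rw [HBk, mem_filter]
        exact ⟨hl, h2, rfl, by simp; omega, by simp; omega⟩
    _ = hexCriticalFugacity * y * ∑ abk ∈ (univ : Finset (Fin (2 * T) × Fin (2 * T))) ×ˢ range K,
          Dk T N abk.2 (abk.1.1 : ℕ) (abk.1.2 : ℕ) y := by
        rw [sum_biUnion hdisj]; rfl
    _ ≤ hexCriticalFugacity * y * ∑ _abk ∈ (univ : Finset (Fin (2 * T) × Fin (2 * T))) ×ˢ range K, C₀ :=
        mul_le_mul_of_nonneg_left (sum_le_sum fun abk _ => hC₀ _ _ _ _) (mul_nonneg hx.1.le hy0)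
    _ = hexCriticalFugacity * y * ((Fintype.card (Fin (2 * T) × Fin (2 * T)) : ℝ) * C₀) * K := by
        rw [sum_const, card_product, card_univ, card_range, nsmul_eq_mul]; push_cast; ring

/-- ★★★ **THE NO-RENEWAL CLASS IS SUMMABLE AT THE THRESHOLD** (`T ≥ 2`): there is `C = C(T)` with
`Σ_{ω ∈ N₀^A(S_{T,L})} x_c^{|ω|} y_T^{#top(ω)} ≤ C` for every box length `L` — the case-A β-walks of the honeycomb strip `S_T` without
renewal point have a FINITE generating function at the critical surface fugacity `y_T`, although `B_T(x_c; y)` itself diverges like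
`(y_T − y)⁻¹`.  Proof: the curtain decomposition `ω ↦ (headP, midP, tailP)` (tree) is injective; by the counting lemma the middle bridge
has at most `|headP| − 1 + |tailP|` pieces; bridges with `≤ K` pieces weigh `O(K)` at `y_T` (`sum_hBridgesN_npieces_le`); and the
top-free heads and bottom-free tails have finite zeroth and first moments in length (`exists_topFreeSumN_le`, `exists_botFreeSumN_le`
of the tree; `exists_topFree_length_mul_le`, `exists_botFree_length_mul_le` above).  Own result of the lane: the crux of the renewal split
of the printed series `B_T(x_c; ·)` (the renewal-free part does not contribute to the residue at `y_T`).
[cite: DuminilCopinHammond2013, §2.2 (renewal points, irreducible bridges); BeatonBousquetMelouDeGierDuminilCopinGuttmann2014, §3.2 Corollary 8 (arXiv v5 p. 12: y_T); DuminilCopinSmirnov2012, §3 (S_{T,L}); lane «pcv-sawmu» a-p2 g20 — own result] -/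
theorem exists_sum_noRenA_stripYT_le (hT : 2 ≤ T) :
    ∃ C : ℝ, ∀ L : ℕ, ∑ l ∈ noRenA T L, hexCriticalFugacity ^ l.length * stripYT T ^ topCnt T l ≤ C := by
  classical
  have hT1 : 1 ≤ T := by omega
  have hx := hexCriticalFugacity_pos_lt_one
  have hyT := one_lt_stripYT hT1
  have hy0 : 0 ≤ stripYT T := by linarith
  set y := stripYT T with hy
  obtain ⟨C₀, -, hC₀⟩ := exists_Dk_stripYT_le hT
  obtain ⟨Cq, hCq⟩ := exists_topFreeSumN_le hT1 (T := T)
  obtain ⟨Cq', hCq'⟩ := exists_topFree_length_mul_le hT1 (T := T)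
  have hν := hexCriticalFugacity_mul_stripNu_pred_stripYT_lt_one hT
  obtain ⟨Cr, hCr⟩ := exists_botFreeSumN_le hT hyT.le hν
  obtain ⟨Cr', hCr'⟩ := exists_botFree_length_mul_le hT hyT.le hν
  set A : ℝ := hexCriticalFugacity * y * ((Fintype.card (Fin (2 * T) × Fin (2 * T)) : ℝ) * C₀) with hA
  have hA0 : 0 ≤ A := by
    have hC₀0 : 0 ≤ C₀ := le_trans (sum_nonneg fun l _ => wD_nonneg T hy0 l) (hC₀ 0 1 ⟨0, by omega⟩ ⟨0, by omega⟩)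
    rw [hA]; exact mul_nonneg (mul_nonneg hx.1.le hy0) (mul_nonneg (Nat.cast_nonneg _) hC₀0)
  refine ⟨A * (Cq' * Cr + Cq * Cr'), fun L => ?_⟩
  obtain ⟨N, hN⟩ : ∃ N : ℕ, (stripV T L).card ≤ N + 1 := ⟨(stripV T L).card, by omega⟩
  have hmem : ∀ l ∈ noRenA T L, l.IsChain hvGraph.Adj ∧ l.head? = some hvOrigin ∧ l.Nodup ∧ (∀ v ∈ l, v ∈ stripV T L) ∧
      (∃ h : l ≠ [], lev (l.getLast h) = 2 * (T : ℤ) - 1) ∧ sIdx l < tIdx l ∧ l.length ≤ N + 1 ∧ renIdxs l = ∅ := by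
    intro l hl
    rw [noRenA, mem_filter, caseA, mem_filter] at hl
    obtain ⟨hc, hh, hnd, hV, hlast⟩ := (mem_bridgeLists_iff hT1).1 hl.1.1
    exact ⟨hc, hh, hnd, hV, hlast, hl.1.2, (length_le_card_stripV hT1 hl.1.1).trans hN, hl.2⟩
  -- piece weights
  set wq : List HV → ℝ := fun q => hexCriticalFugacity ^ (q.length - 1) with hwq
  set wh : List HV → ℝ := fun h => hexCriticalFugacity ^ h.length * y ^ topCnt T h with hwh
  set wr : List HV → ℝ := fun r => hexCriticalFugacity ^ (r.length - 1) * y ^ topCnt T r.tail with hwr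
  have hwq0 : ∀ q, 0 ≤ wq q := fun q => pow_nonneg hx.1.le _
  have hwr0 : ∀ r, 0 ≤ wr r := fun r => mul_nonneg (pow_nonneg hx.1.le _) (pow_nonneg hy0 _)
  set P : List HV × List HV × List HV → Prop := fun t => 2 ≤ t.2.1.length ∧ npieces t.2.1 + 1 ≤ t.1.length + t.2.2.length with hP
  set X := topFreeN T N ×ˢ (hBridgesN T N ×ˢ botFreeN T N) with hX
  -- the four moments
  have hM0q : ∑ q ∈ topFreeN T N, wq q ≤ Cq := hCq N
  have hM1q : ∑ q ∈ topFreeN T N, (q.length : ℝ) * wq q ≤ Cq' := hCq' N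
  have hM0r : ∑ r ∈ botFreeN T N, wr r ≤ Cr := hCr N
  have hM1r : ∑ r ∈ botFreeN T N, (r.length : ℝ) * wr r ≤ Cr' := hCr' N
  have hS0q : 0 ≤ ∑ q ∈ topFreeN T N, (q.length : ℝ) * wq q := sum_nonneg fun q _ => mul_nonneg (Nat.cast_nonneg _) (hwq0 q)
  have hS0r : 0 ≤ ∑ r ∈ botFreeN T N, wr r := sum_nonneg fun r _ => hwr0 r
  have hCq0 : 0 ≤ Cq := le_trans (sum_nonneg fun q _ => hwq0 q) hM0q
  have hCq'0 : 0 ≤ Cq' := le_trans hS0q hM1q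
  calc ∑ l ∈ noRenA T L, hexCriticalFugacity ^ l.length * y ^ topCnt T l
      = ∑ l ∈ noRenA T L, tripleWt T y (decTriple l) := by
        refine sum_congr rfl fun l hl => ?_
        obtain ⟨hc, hh, hnd, hV, -, hst, -⟩ := hmem l hl
        exact wt_eq_tripleWt_decTriple hc hnd hV hh hst y
    _ = ∑ t ∈ (noRenA T L).image decTriple, tripleWt T y t := by
        rw [sum_image]
        intro l hl l' hl' h
        have h1 := hmem l hl; have h2 := hmem l' hl'
        exact decTriple_injOn ⟨by rintro rfl; simp at h1, h1.2.2.2.2.2.1⟩ ⟨by rintro rfl; simp at h2, h2.2.2.2.2.2.1⟩ h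
    _ ≤ ∑ t ∈ X.filter P, tripleWt T y t := by
        refine sum_le_sum_of_subset_of_nonneg (fun t ht => ?_) fun t _ _ => tripleWt_nonneg T hy0 t
        rw [mem_image] at ht
        obtain ⟨l, hl, rfl⟩ := ht
        obtain ⟨hc, hh, hnd, hV, ⟨hne, hlast⟩, hst, hlen, hno⟩ := hmem l hl
        rw [mem_filter, hX, decTriple, mem_product, mem_product]
        refine ⟨⟨headP_mem_topFreeN hc hnd hV hh hst hlen, xstd_midP_mem_hBridgesN hc hnd hV hh hst hlen,
          xstd_tailP_mem_botFreeN hc hnd hV hlast hst hlen⟩, ?_, npieces_midP_succ_le hc hne hst hno⟩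
        have h1 := (length_pieces hne hst).2.1
        have h2 := (t1Idx_spec hne hst).1
        change 2 ≤ (xstd (midP l)).length
        rw [length_xstd]; omega
    _ = ∑ q ∈ topFreeN T N, ∑ r ∈ botFreeN T N,
          ∑ h ∈ (hBridgesN T N).filter (fun h => 2 ≤ h.length ∧ npieces h + 1 ≤ q.length + r.length), wq q * wr r * wh h := by
        rw [sum_filter, hX, sum_product]
        refine sum_congr rfl fun q _ => ?_
        rw [sum_product, sum_comm]
        refine sum_congr rfl fun r _ => ?_
        rw [sum_filter]
        refine sum_congr rfl fun h _ => ?_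
        by_cases hPh : 2 ≤ h.length ∧ npieces h + 1 ≤ q.length + r.length
        · rw [if_pos hPh, if_pos hPh]; simp only [tripleWt, hwq, hwh, hwr]; ring
        · rw [if_neg hPh, if_neg hPh]
    _ ≤ ∑ q ∈ topFreeN T N, ∑ r ∈ botFreeN T N, wq q * wr r * (A * ((q.length : ℝ) + r.length)) := by
        refine sum_le_sum fun q _ => sum_le_sum fun r _ => ?_
        rw [← mul_sum]
        refine mul_le_mul_of_nonneg_left ?_ (mul_nonneg (hwq0 q) (hwr0 r))
        have h := sum_hBridgesN_npieces_le hT hC₀ N (q.length + r.length)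
        push_cast at h
        exact h
    _ = A * ((∑ q ∈ topFreeN T N, (q.length : ℝ) * wq q) * (∑ r ∈ botFreeN T N, wr r) +
          (∑ q ∈ topFreeN T N, wq q) * (∑ r ∈ botFreeN T N, (r.length : ℝ) * wr r)) := by
        rw [sum_mul_sum, sum_mul_sum, ← sum_add_distrib, mul_sum]
        refine sum_congr rfl fun q _ => ?_
        rw [← sum_add_distrib, mul_sum]
        refine sum_congr rfl fun r _ => ?_
        ring
    _ ≤ A * (Cq' * Cr + Cq * Cr') := by
        refine mul_le_mul_of_nonneg_left (add_le_add ?_ ?_) hA0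
        · exact mul_le_mul hM1q hM0r hS0r hCq'0
        · exact mul_le_mul hM0q hM1r (sum_nonneg fun r _ => mul_nonneg (Nat.cast_nonneg _) (hwr0 r)) hCq0

end NoRenewal

end HV

end Literature.Probability.RandomPlanarGeometry.SAW
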